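import Mathlib
import HarnessLib
import HarnessLib.Audit
import Summits.HubbardSuperconductivity.Statement
import Literature.MathematicalPhysics.QuantumLattice.FermionTraceFactorization
import HarnessLib.Audit.Status.Attr

/-!
Route: RvbParentAnchor

DORMANT since 2026-08-22T14:09:20Z (reconciler: no traction for 5.4 d (last activity item-evidence-added at 2026-08-17T04:11:40Z); parked, not closed — `ledger route dormant route-HubbardSuperconductivity-RvbParentAnchor --off` to react) — unstaffed, not closed; items shared with open routes are served there. `ledger route dormant <id> --off` reactivates.

# Route RvbParentAnchor — RVB made finite — a frustration-free d-wave RVB parent Hamiltonian as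
exactly ordered anchor, continued in one coupling to the pure Hubbard model

Card realised: HubbardSuperconductivity/HubbardSuperconductivity/rvb-parent-hamiltonian-anchor
(absorbing the retired rk-rvb-exact-anchor). It suffices to show X = PathLRO:
there are a hole doping δ ∈ (0,1/2) and an ANCHOR — a family P_L ≥ 0 of finite-range (range r),
bounded, even, U(1)×S^z-preserving fermionic Hamiltonians on the even tori (ℤ/Lℤ)²,
FRUSTRATION-FREE in the (N_L, S^z=0) sector, N_L = 2⌊(1−δ)L²/2⌋, EVERY normalised sector ground
state of which has d_{x²−y²} pair-field order ⟨Δ_d†Δ_d⟩ ≥ cL⁴ (and o(L⁴) order in the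
two s channels) — the intended witness being the parent Hamiltonian Σ_R Π_R of the doped B1g RVB
fermionic PEPS (Anderson's RVB state as an injective tensor network) — and a repulsion
U > 0 such that along the whole number-conserving path H_L(s) = hubbardTorus 2 L 1 U + s·P_L, s ∈
(0,∞), every normalised sector ground state keeps ⟨Δ_d†Δ_d⟩ ≥ c'L⁴ with ONE c' > 0
(L ≥ L₁ even, uniformly in s), the Hubbard sector ground state at (U,δ) being simple for large even
L. X = ANCHOR ∧ CONTINUATION: AnchorExists is the s = ∞ shadow of PathLRO
(PathLRO → AnchorExists by projection, checked in the planner's Sketch3.lean) and the route's first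
deliverable; PathLRO is the bet.
Lean: `PathLRO`

## Assembly
Pure logic plus the support lemma: given PathLRO, unpack (δ, c, r, L₀, P, anchor spec, U, c', L₁,
path block) and apply EndpointTransfer at (U, δ, c', P) to get the summit body at (U,δ), i.e.
HubbardSuperconductivity with witnesses U, δ (HubbardSuperconductivity_iff is Iff.rfl). AnchorExists
is consumed vacuously (it is implied by PathLRO: anchorExists_of_pathLRO in Sketch3.lean); it is
listed first because it is the route's first milestone and the node that will be split first.
Verified: `theorem assembly_of_endpointTransfer (hT : EndpointTransfer) : Assembly` elaborates
(planner folder Sketch3.lean, rc 0).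

Rationale: WHY THIS LINE. Anderson's claim 'the doped Hubbard ground state is an RVB superconductor'
(Anderson1987) becomes a statement about ONE path in Hamiltonian space with a THEOREM at one end:
injective
(fermionic) PEPS have frustration-free finite-range parent Hamiltonians whose ground space is the
tensor's symmetry orbit (PerezGarciaVerstraeteWolfCirac2008PEPS,
KrausSchuchVerstraeteCirac2010, SchuchPoilblancCiracPerezGarcia2012), doped d-wave RVB
superconductors ARE such fPEPS of bond dimension ≤ 4 (PoilblancCorbozSchuchCirac2014), and for a
U(1)-covariant family the torus ground space in each (N,S^z) sector is the number projection of the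
condensate, so d-wave pair order of every sector ground state is read off an
explicit state (ODLRO Φ_d ≠ 0 + clustering + equivalence of ensembles) — the d-wave analogue of the
proved frustration-free η-pairing superconductors (DeboerKorepinSchadschneider1995)
and of the 2D number-conserving exact p-wave models (WangXuPuHazzard2017); nothing of the kind
exists for B1g pairing. Imported area: tensor-network parent-Hamiltonian theory
(quantum information) plus transfer-operator cluster expansions for the anchor; the continuation
imports nothing (no tool exists) and is posed so that its endpoint bookkeeping
(EndpointTransfer) is provable now. Versus the other anchor routes of this sub: PlaquetteBoson
anchors by reflection positivity on a checkerboard model and continues in t';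
here there is no RP, no small hopping and no effective boson — the anchor order comes from a
closed-form state, the path is the parent-penalty strength at FIXED uniform hopping.

RANKED CRUXES. #2 PathLRO (crux) — ANCHOR ∧ CONTINUATION (card items A1–A4): ∃ δ∈(0,1/2), c>0, r, L₀
and P = (P_L) with the anchor specification of AnchorExists, and ∃ U>0, c'>0, L₁ such that for every
even L ≥ L₁: P_L is Hermitian and maps the (N_L,0) sector into itself; for EVERY s>0 every
normalised (N_L,0)-sector ground state ψ of hubbardTorus 2 L 1 U + s·P_L has Re⟨ψ, Δ_d†Δ_d ψ⟩ ≥ c'L⁴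
(c' independent of s and L); and any two (N_L,0)-sector ground states of hubbardTorus 2 L 1 U are
proportional (simple sector ground state — the every-ground-state clause of the summit forces
control of the whole ground eigenspace; simplicity at the chosen (U,δ) is the minimal honest
hypothesis, generic in U by Rellich-type reasoning but unproved). [deps: AnchorExists] [difficulty:
open-problem] (why it might fail: No tool for persistence of U(1) ground-state order in d=2; a
stripe/phase-separation/Fermi-liquid transition at some s for every RVB anchor and every (U,δ) (t'=0
stripes: QinEtAl2020); the FF anchor has flat E_N (infinite compressibility), so even s→∞ may be
non-uniform in L.) [Anderson1987, PoilblancCorbozSchuchCirac2014, QinEtAl2020,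
ArovasBergKivelsonRaghu2022, Sorella2023, MasaokaSoejimaWatanabe2024, arXiv:2503.12879]
#3 AnchorExists (crux) — THE d-WAVE FRUSTRATION-FREE ANCHOR (card A1+A2; first deliverable): ∃
δ∈(0,1/2), c>0, r, L₀, P=(P_L) and γ_L → 0 such that for every even L ≥ L₀: P_L = Σ_{x∈(ℤ/L)²} Φ_x
with Φ_x Hermitian, 0 ≤ Φ_x ≤ 1 (as quadratic forms) and Φ_x in the EVEN CAR algebra of the orbitals
over the torus ball B(x,r) (finite range, bounded, fermion-even local terms); P_L maps the (N_L,0)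
sector into itself; P_L has a zero-energy state in that sector (frustration-free there, so sector
ground states = sector kernel); and EVERY normalised sector ground state ψ has Re⟨ψ,Δ_d†Δ_dψ⟩ ≥ cL⁴
while the on-site-s and extended-s pair fields have Re⟨ψ,Δ_s†Δ_sψ⟩ ≤ γ_L L⁴ (genuine B1g order, not
a dressed s/η condensate — the typed guard standing in for D4/translation symmetry of P until a
second-quantised relabelling unitary is defined). Intended proof: doped B1g RVB fPEPS tensor in a
dilute/dimerised provable regime → blocked (G-)injectivity by exact rank computation → canonical
parent Σ_R Π_R (range r = block diameter) with torus ground space = number/spin projections of the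
U(1)×SU(2) orbit → Φ_d ≠ 0 and exponential clustering by a transfer-operator cluster expansion →
number projection by equivalence of ensembles. [difficulty: XL] (why it might fail: The n.n.
square-lattice RVB PEPS is NOT injective (SPCP2012: extra/topological ground states) and has
critical dimer correlations; a tensor regime that is simultaneously provably injective, clustering
and d-wave ordered (Φ_d≠0) may not exist at any δ∈(0,1/2).) [SchuchPoilblancCiracPerezGarcia2012,
PoilblancCorbozSchuchCirac2014, PerezGarciaVerstraeteWolfCirac2008PEPS,
KrausSchuchVerstraeteCirac2010, DeboerKorepinSchadschneider1995, WangXuPuHazzard2017, Tasaki1993,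
ParamekantiRanderiaTrivedi2001]
#9 EndpointTransfer (support) — ENDPOINT BOOKKEEPING (provable now, finite-dimensional): for all
U>0, δ∈(0,1/2), c'>0 and any family P, if from some L₁ on (even L) P_L is Hermitian and
sector-preserving, every sector ground state of hubbardTorus 2 L 1 U + s·P_L has Re⟨Δ_d†Δ_d⟩ ≥ c'L⁴
for every s>0, and the Hubbard sector ground state is simple, then the summit's conclusion holds at
(U,δ): every admissible ground-state sequence ψ has HasLongRangeOrder of torusPullback
(pairFieldCorr dWaveFormFactor ψ) along even sides. Proof: sector ground states of H(s) exist
(Hermitian + invariant coordinate sector: SectorSpectrum.sector_groundState); take s = 1/n,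
normalise, extract a convergent subsequence on the unit sphere; the limit is a sector eigenvector of
H(0) at the limiting sector minimum (|minEnergyOn(H+sP) − minEnergyOn(H)| ≤ s‖P_L‖), hence by
simplicity a phase multiple of ψ_L; the quadratic form ψ ↦ Re⟨ψ,Δ_d†Δ_dψ⟩ is continuous and
phase-invariant, so L⁻⁴Re⟨Δ_d†Δ_d⟩_{ψ_L} ≥ c' for even L ≥ L₁; finally
Σ_{x,y∈halfOpenBox}torusPullback = Σ_{x,y} pairFieldCorr = Re expect(Δ_d†Δ_d)
(torusProj_bijOn_halfOpenBox, expect_pairField_conjTranspose_mul, card_halfOpenBox) and liminf ≥ c'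
> 0 (the sequence is bounded by ‖Δ_d‖²L⁻⁴ = O(1)). [difficulty: provable-now] [LiebWuPhysicaA2003,
Scalapino1995]

TWO-LAYER PLAN. Foreseen first split (once the fPEPS definitions land and the explicit tensor T(δ)
is fixed): AnchorExists ⇐ RvbParentGroundSpace(T) → RvbCondensateOrder(T) → AnchorExists, with
RvbParentGroundSpace(T) = blocked injectivity + 'torus ground space of Σ_R Π_R in sector (N,S^z) =
span of projections of the symmetry orbit' (finite linear algebra + the fermionic
PEPS parent theorem) and RvbCondensateOrder(T) = Φ_d(δ) ≠ 0, exponential clustering of the 2- and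
4-point pair functions and ⟨(ΔN)²⟩ = O(L²) for |Ψ_T⟩ ⇒ sector LRO ≥ Φ_d²/2 by the
number-projection (equivalence-of-ensembles) lemma, which rides as a --supports lemma. Second split,
of PathLRO given the anchor P_T: LargeCouplingUniformity (the s → ∞ end is
uniform in L: no phase separation at first order in 1/s, i.e. convexity of the RVB variational
Hubbard energy in the density) → FullPath → PathLRO. The two informal cruxes filed right
after open (RvbParentGroundSpace, rank 4; AnchorNoPhaseSeparation, rank 5) are the cheap, decisive
versions of these children.

KILL CRITERIA. (i) Exact rank computations show that NO doped B1g RVB tensor of bond dimension ≤ 4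
(PSC2014 family, with or without longer singlets / plaquette decoration) is (G-)injective after
blocking up to 4×4 — the parent ground space is then uncontrolled (the known square-lattice RVB
subtlety) and AnchorExists loses its intended witness: pivot to plaquette-dimerised
tensors (converging with route PlaquetteBoson's anchor) or close exhausted. (ii) VMC/iPEPS along
H(s) at every tried (U,δ) shows the d-wave order parameter collapsing at some
s_c > 0, or the RVB variational Hubbard energy e_var(n) concave at n = 1−δ for all δ where Φ_d ≠ 0
(phase separation at the anchor end): close refuted-in-spirit (PathLRO itself is
an unrefutable existential; the census goes on the item). (iii) A refutation of EndpointTransfer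
would only be a bookkeeping error — restate. (iv) NoGo-type regional theorems
(route NoGo) covering every (U,δ) window where RVB tensors have Φ_d ≠ 0 moot the line.

NOT DECOMPOSED YET. Deliberately NOT filed now: the fPEPS objects themselves (definition requests
below) and therefore every statement about the explicit tensor; the number-projection /
equivalence-of-ensembles lemma (layer-2 support under AnchorExists); the transfer-operator cluster
expansion (layer 2); any mechanism for the continuation (openness of U(1) order
under symmetric finite-range perturbations is open and shared with PlaquetteBoson's PbContinuation
and card bcs-deformation-ladder — not duplicated here); D4/translation
symmetry of P as a typed hypothesis (needs the relabelling unitary; the s-channel guard stands in);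
the weak-U corner (the path would have to cross the e^{-1/U²} regime — the
target window is U ≈ 6–10, δ ≈ 0.15–0.25, away from (8,1/8)).

CHEAPEST FALSIFIER. Injectivity rank test of the PSC2014 doped d-wave RVB tensor: build the D ≤ 4
fermionic tensor (singlet-bond + hole channel, B1g signs), block 2×2 and 3×3, and compute the rank
of
the map from virtual boundary space (even-parity sector) to physical space exactly over ℚ(√2) —
minutes of linear algebra (kit compute; not run this session: the compute-free hub's
kit daemon was not exercised because the tensor conventions must first be fixed in the definition
request). Non-injectivity for all blockings ≤ 4×4 kills the intended witness of
AnchorExists (kill criterion i). Second cheapest: VMC convexity scan of e_var(n) for the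
Gutzwiller-projected d-wave RVB at U = 8 (literature values exist: phase separation only at
small δ, ArovasBergKivelsonRaghu2022 §8.1 p.31).

NUMBERS. Target window U ≈ 6–10, δ ≈ 0.15–0.25 (avoid (8, 1/8): PureModelStripeCompetition).
RVB/projected-BCS d-wave order parameter Φ_d(δ) ∝ δ at small δ, maximal near δ ≈ 0.2
(ParamekantiRanderiaTrivedi2001). PSC2014 RVB superconducting fPEPS: bond dimension D = 3 (singlet +
hole) to 4. FF gapless anchors have dynamical exponent z ≥ 2, finite-size
gap O((log L)²/L²) (MasaokaSoejimaWatanabe2024, MasaokaSoejimaWatanabe2025, arXiv:2503.12879) — the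
anchor's phase mode is quadratic, not a superfluid phonon. Items at open: 4
typed (2 cruxes, 1 support, 1 assembly) + 2 informal cruxes added after open = 6.

DEFINITION REQUESTS. (1) fermionicPEPS — the state in Fock(Orb(FermionTorus 2 L)) obtained by
contracting a translation-repeated fermionic (ℤ₂-graded) local tensor with physical legs = the 4-dim
site Hilbert space and virtual legs of dimension D around the torus (KrausSchuchVerstraeteCirac2010;
Grassmann/fermionic contraction order fixed by the Lex order of FermionTorus).
(2) pepsParentHamiltonian — for a region shape R (block), Π_R = projector onto the orthocomplement
of the range of the blocked tensor map on R, embedded as an even local operator,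
and H_P = Σ_{translates} Π_R (PerezGarciaVerstraeteWolfCirac2008PEPS,
SchuchPoilblancCiracPerezGarcia2012). (3) fockRelabel — the unitary on Fock(ι) implementing an
orbital
bijection π (c_i ↦ c_{πi}, with Jordan–Wigner reordering signs; = transport of ExteriorAlgebra.map
through fockExteriorEquiv), giving torus translations and the D4 action as
operators so that symmetry of P can be typed. Cite facts wanted: the PEPS parent-Hamiltonian
ground-space theorem (injective case, torus) and its fermionic version.

Novelty: Searches (2026-08-15; local searchd DOWN rc 75, OpenAlex/S2/arXiv APIs 429 — crossref, zbMATH,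
galaxy and the citation map used): `lit search --source crossref` ×10
('eta pairing d-wave exact eigenstate Hubbard' → Su et al. 1991-92, Essler 1995, Wang–Qiu–Zhou 1995
rigorous η GS; 'number-conserving … exact topological superconducting ground
states' → doi:10.1103/physrevb.96.115110 WangXuPuHazzard2017, Sato 1996; 'resonating valence bond
superconductors fermionic PEPS' → doi:10.1103/physrevb.89.241106
PoilblancCorbozSchuchCirac2014, KrausSchuchVerstraeteCirac2010; 'exact RVB ground state … Tasaki' →
Tasaki1993, doi:10.1103/physrevb.107.l140401 Kim2023HoleRVB,
YamanakaHonjoHatsugaiKohmoto1996; 'frustration-free fermionic systems gapless' →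
MasaokaSoejimaWatanabe2024, doi:10.1103/d4c4-5p2r, FernandezGonzalezSchuchWolfCiracPerezGarcia2015;
'generalization of eta-pairing' → YoshidaKatsura2022; 'Montorsi Campbell' → MontorsiCampbell1996),
`lit search --source zbmath 'eta pairing unconventional'` (2: Moudgalya–Motrunich
scars, Czart et al.), `lit galaxy search --star all` ×5 ('eta pairing d-wave exact eigenstate',
'exact superconducting ground state', 'doped resonating valence bond', 'resonating
valence bond states in the PEPS', all 0 rows; 'number-conserving' 8+8 irrelevant), `lit frontier
HubbardSuperconductivity --since 2023` (arXiv:2503.12879 FF fermionic systems,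
arXiv:2503.14312 FF free fermions, arXiv:2605.12907 Grassmann tensor networks), `lit read
arXiv:cond-mat/9512169` p.1  [refs: 10.1103/physrevb.96.115110, 10.1103/physrevb.89.241106, 10.1103/physrevb.107.l140401, 10.1103/d4c4-5p2r, 2503.12879, 2503.14312, 2605.12907, cond-mat/9512169, 2103.12097, doi:10.1103/physrevb.96.115110, doi:10.1103/physrevb.89.241106, doi:10.1103/physrevb.107.l140401, doi:10.1103/d4c4-5p2r, WangXuPuHazzard2017, PoilblancCorbozSchuchCirac2014, KrausSchuchVerstraeteCirac2010, Tasaki1993, YamanakaHon]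

Barriers (technique_class: tensor-network-parent-hamiltonian; deformation-path): - technique_class: tensor-network-parent-hamiltonian; deformation-path
- Literature.Barriers.HubbardSuperconductivity.LROForcesLowLyingStates: respected and used as a
design constraint — every order statement is ⟨Δ_d†Δ_d⟩ ≥ cL⁴ for fixed-N sector ground states (no
anomalous average, no uniqueness-with-uniform-gap claim on Fock space); the U(1)-symmetric FF parent
has the whole number tower at energy 0, exactly the low-lying states the theorem forces; within a
sector the anchor is gapless with z ≥ 2 (MasaokaSoejimaWatanabe2024), so no gapped-phase stability
(Michalakis–Zwolak/LTQO) is invoked anywhere.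
- Literature.Barriers.HubbardSuperconductivity.StrongCouplingCeiling: evaded — no t/U,
high-temperature, cluster or Pirogov–Sinai expansion of the Hubbard model; the only expansion is the
transfer-operator cluster expansion of the ANCHOR PEPS around a product/dimer point (a different
object, T = 0, explicit state); the continuation is where the barrier's moral ('no expansion reaches
the SU(2) ground state') returns, acknowledged as the bet PathLRO.
- Literature.Barriers.HubbardSuperconductivity.WeakCouplingCeiling: not in class — no expansion in
U; target window U ≈ 6–10; the route states openly that the path is implausible at weak U (it would
cross the e^{-1/U²} regime).
- Literature.Barriers.HubbardSuperconductivity.PerturbativeInvisibilityOfPairing: not in class —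
nothing is read off a power series in U.
- Literature.Barriers.HubbardSuperconductivity.GeneralizedHartreeFockNoP

History (route lifecycle, newest last):
- 2026-08-22T14:09:20Z · DORMANT — reconciler: no traction for 5.4 d (last activity item-evidence-added at 2026-08-17T04:11:40Z); parked, not closed — `ledger route dormant route-HubbardSupercond (operator:999:3022662)

sub-problem: HubbardSuperconductivity · status: dormant · opened planner-plancard-HubbardSuperconductivity-Hub-e8940632-0 2026-08-15T11:06:45Z · rev 2 · ledger route-HubbardSuperconductivity-RvbParentAnchor
GENERATED by the gate from the ledger (D-0016/17). Provers cite these decls: `theorem foo : Summit.HubbardSuperconductivity.HubbardSuperconductivity.Theses.RvbParentAnchor.<Decl> := …` in Summits/HubbardSuperconductivity/HubbardSuperconductivity/Theorems/<Name>.lean.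
-/

namespace Summit.HubbardSuperconductivity.HubbardSuperconductivity.Theses.RvbParentAnchor

open scoped BigOperators Topology Manifold Classical MeasureTheory ProbabilityTheory Matrix InnerProductSpace ComplexConjugate ContinuousMap
open Filter Set Function TopologicalSpace MeasureTheory

attribute [summit_statement] _root_.HubbardSuperconductivity

open Literature.Hubbard

/-- item stmt-HubbardSuperconductivity-2654 · crux · rank 2 · open · by planner
why it might fail: No tool for persistence of U(1) ground-state order in d=2; a stripe/phase-separation/Fermi-liquid transition at some s for every RVB anchor and every (U,δ) (t'=0 stripes: QinEtAl2020); the FF anchor has flat E_N (infinite compressibility), so even s→∞ may be non-uniform in L.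
sources: Anderson1987, PoilblancCorbozSchuchCirac2014, QinEtAl2020, ArovasBergKivelsonRaghu2022, Sorella2023, MasaokaSoejimaWatanabe2024
[crux] ANCHOR ∧ CONTINUATION (card items A1–A4): ∃ δ∈(0,1/2), c>0, r, L₀ and P = (P_L) with the
anchor specification of AnchorExists, and ∃ U>0, c'>0, L₁ such that for every even L ≥ L₁: P_L is
Hermitian and maps the (N_L,0) sector into itself; for EVERY s>0 every normalised (N_L,0)-sector
ground state ψ of hubbardTorus 2 L 1 U + s·P_L has Re⟨ψ, Δ_d†Δ_d ψ⟩ ≥ c'L⁴ (c' independent of s and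
L); and any two (N_L,0)-sector ground states of hubbardTorus 2 L 1 U are proportional (simple sector
ground state — the every-ground-state clause of the summit forces control of the whole ground
eigenspace; simplicity at the chosen (U,δ) is the minimal honest hypothesis, generic in U by
Rellich-type reasoning but unproved). [deps: AnchorExists] [difficulty: open-problem] -/
@[route_item "route-HubbardSuperconductivity-RvbParentAnchor", crux]
def PathLRO : Prop :=
  ∃ δ ∈ Set.Ioo (0:ℝ) (1/2), ∃ c : ℝ, 0 < c ∧ ∃ r L₀ : ℕ, ∃ P : (L : ℕ) → Matrix (Finset (Literature.MathematicalPhysics.QuantumLattice.Orb (Literature.MathematicalPhysics.QuantumLattice.FermionTorus 2 L))) (Finset (Literature.MathematicalPhysics.QuantumLattice.Orb (Literature.MathematicalPhysics.QuantumLattice.FermionTorus 2 L))) ℂ, (∃ γ : ℕ → ℝ, Tendsto γ atTop (𝓝 0) ∧ ∀ (L : ℕ) [NeZero L], Even L → L₀ ≤ L → (P L).IsHermitian ∧ (∃ Φ : Literature.Probability.LatticeModels.TorusSite 2 L → _, P L = ∑ x, Φ x ∧ ∀ x, (Φ x).IsHermitian ∧ (∀ v, 0 ≤ (star v ⬝ᵥ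 (Φ x *ᵥ v)).re ∧ (star v ⬝ᵥ (Φ x *ᵥ v)).re ≤ (star v ⬝ᵥ v).re) ∧ Φ x ∈ Literature.MathematicalPhysics.QuantumLattice.carEvenSubalgebra ((Literature.MathematicalPhysics.QuantumLattice.torusBall x r ×ˢ Finset.univ).image fun p => Literature.MathematicalPhysics.QuantumLattice.orb (Literature.MathematicalPhysics.QuantumLattice.FermionTorus.ofTorusSite p.1) p.2)) ∧ (∀ v, v ∈ Literature.MathematicalPhysics.QuantumLattice.szSector (2 * ⌊(1 - δ) * (L : ℝ) ^ 2 / 2⌋₊) 0 → P L *ᵥ v ∈ Literature.MathematicalPhysics.QuantumLattice.szSector (2 * ⌊(1 - δ) * (L : ℝ) ^ 2 / 2⌋₊) 0) ∧ (∃ v, v ∈ Literature.MathematicalPhysics.QuantumLattice.szSector (2 * ⌊(1 - δ) * (L : ℝ) ^ 2 / 2⌋₊) 0 ∧ v ≠ 0 ∧ P L *ᵥ v = 0) ∧ (∀ ψ, Literature.MathematicalPhysics.QuantumLattice.IsGroundStateInSector (P L) (2 * ⌊(1 - δ) * (L : ℝ) ^ 2 / 2⌋₊) 0 ψ → star ψ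 ⬝ᵥ ψ = 1 → c * (L : ℝ) ^ 4 ≤ (Literature.MathematicalPhysics.QuantumLattice.expect ((Literature.MathematicalPhysics.QuantumLattice.pairField Literature.MathematicalPhysics.QuantumLattice.dWaveFormFactor L)ᴴ * Literature.MathematicalPhysics.QuantumLattice.pairField Literature.MathematicalPhysics.QuantumLattice.dWaveFormFactor L) ψ).re ∧ (Literature.MathematicalPhysics.QuantumLattice.expect ((Literature.MathematicalPhysics.QuantumLattice.pairField Literature.MathematicalPhysics.QuantumLattice.sWave L)ᴴ * Literature.MathematicalPhysics.QuantumLattice.pairField Literature.MathematicalPhysics.QuantumLattice.sWave L) ψ).re ≤ γ L * (L : ℝ) ^ 4 ∧ (Literature.MathematicalPhysics.QuantumLattice.expect ((Literature.MathematicalPhysics.QuantumLattice.pairField Literature.MathematicalPhysics.QuantumLattice.extendedSWave L)ᴴ * Literature.MathematicalPhysics.QuantumLattice.pairField Literature.MathematicalPhysics.QuantumLattice.extendedSWave L) ψ).re ≤ γ L * (L : ℝ) ^ 4)) ∧ ∃ U : ℝ, 0 < U ∧ ∃ c' : ℝ, 0 < c' ∧ ∃ L₁ : ℕ, ∀ (L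 : ℕ) [NeZero L], Even L → L₁ ≤ L → (P L).IsHermitian ∧ (∀ v, v ∈ Literature.MathematicalPhysics.QuantumLattice.szSector (2 * ⌊(1 - δ) * (L : ℝ) ^ 2 / 2⌋₊) 0 → P L *ᵥ v ∈ Literature.MathematicalPhysics.QuantumLattice.szSector (2 * ⌊(1 - δ) * (L : ℝ) ^ 2 / 2⌋₊) 0) ∧ (∀ s : ℝ, 0 < s → ∀ ψ, Literature.MathematicalPhysics.QuantumLattice.IsGroundStateInSector (Literature.MathematicalPhysics.QuantumLattice.hubbardTorus 2 L 1 U + (s : ℂ) • P L) (2 * ⌊(1 - δ) * (L : ℝ) ^ 2 / 2⌋₊) 0 ψ → star ψ ⬝ᵥ ψ = 1 → c' * (L : ℝ) ^ 4 ≤ (Literature.MathematicalPhysics.QuantumLattice.expect ((Literature.MathematicalPhysics.QuantumLattice.pairField Literature.MathematicalPhysics.QuantumLattice.dWaveFormFactor L)ᴴ * Literature.MathematicalPhysics.QuantumLattice.pairField Literature.MathematicalPhysics.QuantumLattice.dWaveFormFactor L) ψ).re) ∧ (∀ ψ₁ ψ₂, Literature.MathematicalPhysics.QuantumLattice.IsGroundStateInSector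 (Literature.MathematicalPhysics.QuantumLattice.hubbardTorus 2 L 1 U) (2 * ⌊(1 - δ) * (L : ℝ) ^ 2 / 2⌋₊) 0 ψ₁ → Literature.MathematicalPhysics.QuantumLattice.IsGroundStateInSector (Literature.MathematicalPhysics.QuantumLattice.hubbardTorus 2 L 1 U) (2 * ⌊(1 - δ) * (L : ℝ) ^ 2 / 2⌋₊) 0 ψ₂ → ∃ a : ℂ, ψ₂ = a • ψ₁)

/-- item stmt-HubbardSuperconductivity-2655 · crux · rank 3 · open · by planner
why it might fail: The n.n. square-lattice RVB PEPS is NOT injective (SPCP2012: extra/topological ground states) and has critical dimer correlations; a tensor regime that is simultaneously provably injective, clustering and d-wave ordered (Φ_d≠0) may not exist at any δ∈(0,1/2).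
sources: SchuchPoilblancCiracPerezGarcia2012, PoilblancCorbozSchuchCirac2014, PerezGarciaVerstraeteWolfCirac2008PEPS, KrausSchuchVerstraeteCirac2010, DeboerKorepinSchadschneider1995, WangXuPuHazzard2017
[crux] THE d-WAVE FRUSTRATION-FREE ANCHOR (card A1+A2; first deliverable): ∃ δ∈(0,1/2), c>0, r, L₀,
P=(P_L) and γ_L → 0 such that for every even L ≥ L₀: P_L = Σ_{x∈(ℤ/L)²} Φ_x with Φ_x Hermitian, 0 ≤
Φ_x ≤ 1 (as quadratic forms) and Φ_x in the EVEN CAR algebra of the orbitals over the torus ball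
B(x,r) (finite range, bounded, fermion-even local terms); P_L maps the (N_L,0) sector into itself;
P_L has a zero-energy state in that sector (frustration-free there, so sector ground states = sector
kernel); and EVERY normalised sector ground state ψ has Re⟨ψ,Δ_d†Δ_dψ⟩ ≥ cL⁴ while the on-site-s and
extended-s pair fields have Re⟨ψ,Δ_s†Δ_sψ⟩ ≤ γ_L L⁴ (genuine B1g order, not a dressed s/η condensate
— the typed guard standing in for D4/translation symmetry of P until a second-quantised relabelling
unitary is defined). Intended proof: doped B1g RVB fPEPS tensor in a dilute/dimerised provable
regime → blocked (G-)injectivity by exact rank computation → canonical parent Σ_R Π_R (range r =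
block diameter) with torus ground space = number/spin projections of the U(1)×SU(2) orbit → Φ_d ≠ 0
and exponential clustering by a transfer-operator cluster expansion → number projection by
equivalence of ens -/
@[route_item "route-HubbardSuperconductivity-RvbParentAnchor"]
def AnchorExists : Prop :=
  ∃ δ ∈ Set.Ioo (0:ℝ) (1/2), ∃ c : ℝ, 0 < c ∧ ∃ r L₀ : ℕ, ∃ P : (L : ℕ) → Matrix (Finset (Literature.MathematicalPhysics.QuantumLattice.Orb (Literature.MathematicalPhysics.QuantumLattice.FermionTorus 2 L))) (Finset (Literature.MathematicalPhysics.QuantumLattice.Orb (Literature.MathematicalPhysics.QuantumLattice.FermionTorus 2 L))) ℂ, ∃ γ : ℕ → ℝ, Tendsto γ atTop (𝓝 0) ∧ ∀ (L : ℕ) [NeZero L], Even L → L₀ ≤ L → (P L).IsHermitian ∧ (∃ Φ : Literature.Probability.LatticeModels.TorusSite 2 L → _, P L = ∑ x, Φ x ∧ ∀ x, (Φ x).IsHermitian ∧ (∀ v, 0 ≤ (star v ⬝ᵥ (Φ x *ᵥ v)).re ∧ (star v ⬝ᵥ (Φ x *ᵥ v)).re ≤ (star v ⬝ᵥ v).re)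 ∧ Φ x ∈ Literature.MathematicalPhysics.QuantumLattice.carEvenSubalgebra ((Literature.MathematicalPhysics.QuantumLattice.torusBall x r ×ˢ Finset.univ).image fun p => Literature.MathematicalPhysics.QuantumLattice.orb (Literature.MathematicalPhysics.QuantumLattice.FermionTorus.ofTorusSite p.1) p.2)) ∧ (∀ v, v ∈ Literature.MathematicalPhysics.QuantumLattice.szSector (2 * ⌊(1 - δ) * (L : ℝ) ^ 2 / 2⌋₊) 0 → P L *ᵥ v ∈ Literature.MathematicalPhysics.QuantumLattice.szSector (2 * ⌊(1 - δ) * (L : ℝ) ^ 2 / 2⌋₊) 0) ∧ (∃ v, v ∈ Literature.MathematicalPhysics.QuantumLattice.szSector (2 * ⌊(1 - δ) * (L : ℝ) ^ 2 / 2⌋₊) 0 ∧ v ≠ 0 ∧ P L *ᵥ v = 0) ∧ (∀ ψ, Literature.MathematicalPhysics.QuantumLattice.IsGroundStateInSector (P L) (2 * ⌊(1 - δ) * (L : ℝ) ^ 2 / 2⌋₊) 0 ψ → star ψ ⬝ᵥ ψ = 1 → c * (L : ℝ) ^ 4 ≤ (Literature.MathematicalPhysics.QuantumLattice.expect ((Literature.MathematicalPhysics.QuantumLattice.pairField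 Literature.MathematicalPhysics.QuantumLattice.dWaveFormFactor L)ᴴ * Literature.MathematicalPhysics.QuantumLattice.pairField Literature.MathematicalPhysics.QuantumLattice.dWaveFormFactor L) ψ).re ∧ (Literature.MathematicalPhysics.QuantumLattice.expect ((Literature.MathematicalPhysics.QuantumLattice.pairField Literature.MathematicalPhysics.QuantumLattice.sWave L)ᴴ * Literature.MathematicalPhysics.QuantumLattice.pairField Literature.MathematicalPhysics.QuantumLattice.sWave L) ψ).re ≤ γ L * (L : ℝ) ^ 4 ∧ (Literature.MathematicalPhysics.QuantumLattice.expect ((Literature.MathematicalPhysics.QuantumLattice.pairField Literature.MathematicalPhysics.QuantumLattice.extendedSWave L)ᴴ * Literature.MathematicalPhysics.QuantumLattice.pairField Literature.MathematicalPhysics.QuantumLattice.extendedSWave L) ψ).re ≤ γ L * (L : ℝ) ^ 4)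

-- item stmt-HubbardSuperconductivity-2775 · crux · rank 4 · open · by planner — informal only, no Lean statement yet:
--   [crux] RVB PARENT GROUND SPACE (card A1; kill criterion (i); informal until the definition requests
--   fermionicPEPS / pepsParentHamiltonian land). For the doped d_{x²−y²} RVB fermionic PEPS tensor
--   family T(δ) of Poilblanc–Corboz–Schuch–Cirac 2014 on the square lattice (virtual space ℂ^D, D = 3:
--   singlet channel ⊕ hole channel, or D = 4 with longer singlets; B1g bond signs; U(1)-charge and
--   SU(2)-spin covariant tensors), there are a blocking size b ≤ 4 and hence a range r such that the
--   b×b-blocked tensor is injective on the even-fermion-parity virtual boundary space (G-injective with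
--   G ⊇ fermion pa

-- item stmt-HubbardSuperconductivity-2783 · crux · rank 5 · open · by planner — informal only, no Lean statement yet:
--   [crux] NO PHASE SEPARATION AT THE ANCHOR END (refuter caveat (i) on the card; kill criterion (ii);
--   informal until fermionicPEPS lands). A U(1)-symmetric frustration-free parent has E_N(P_L) = 0 for
--   every N in the tower: the anchor is infinitely compressible, and at first order in 1/s the ground
--   states of hubbardTorus 2 L 1 U + s·P_L inside the (N_L,0) sector are selected by the RVB VARIATIONAL
--   Hubbard energy. CLAIM: for the tensor T(δ) of RvbParentGroundSpace and the route's U, the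
--   variational energy density e_var(n) := lim_{L→∞} L⁻² ⟨Ψ_{T,N}, hubbardTorus 2 L 1 U Ψ_{T,N}⟩ /
--   ‖Ψ_{T,N}‖² (Ψ_{T,N

/-- item stmt-HubbardSuperconductivity-2656 · support · rank 9 · closed · proved by Summit.HubbardSuperconductivity.HubbardSuperconductivity.Theorems.RvbParentAnchor.endpointTransfer_proof @ ea2f0a5bd603 (prover) · by planner
sources: LiebWuPhysicaA2003, Scalapino1995
[support] ENDPOINT BOOKKEEPING (provable now, finite-dimensional): for all U>0, δ∈(0,1/2), c'>0 and
any family P, if from some L₁ on (even L) P_L is Hermitian and sector-preserving, every sector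
ground state of hubbardTorus 2 L 1 U + s·P_L has Re⟨Δ_d†Δ_d⟩ ≥ c'L⁴ for every s>0, and the Hubbard
sector ground state is simple, then the summit's conclusion holds at (U,δ): every admissible
ground-state sequence ψ has HasLongRangeOrder of torusPullback (pairFieldCorr dWaveFormFactor ψ)
along even sides. Proof: sector ground states of H(s) exist (Hermitian + invariant coordinate
sector: SectorSpectrum.sector_groundState); take s = 1/n, normalise, extract a convergent
subsequence on the unit sphere; the limit is a sector eigenvector of H(0) at the limiting sector
minimum (|minEnergyOn(H+sP) − minEnergyOn(H)| ≤ s‖P_L‖), hence by simplicity a phase multiple of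
ψ_L; the quadratic form ψ ↦ Re⟨ψ,Δ_d†Δ_dψ⟩ is continuous and phase-invariant, so
L⁻⁴Re⟨Δ_d†Δ_d⟩_{ψ_L} ≥ c' for even L ≥ L₁; finally Σ_{x,y∈halfOpenBox}torusPullback = Σ_{x,y}
pairFieldCorr = Re expect(Δ_d†Δ_d) (torusProj_bijOn_halfOpenBox, expect_pairField_conjTranspose_mul,
card_halfOpenBox) and liminf ≥ c' > 0 (the sequence is bounded -/
@[route_item "route-HubbardSuperconductivity-RvbParentAnchor", crux]
def EndpointTransfer : Prop :=
  ∀ (U δ c' : ℝ) (P : (L : ℕ) → Matrix (Finset (Literature.MathematicalPhysics.QuantumLattice.Orb (Literature.MathematicalPhysics.QuantumLattice.FermionTorus 2 L))) (Finset (Literature.MathematicalPhysics.QuantumLattice.Orb (Literature.MathematicalPhysics.QuantumLattice.FermionTorus 2 L))) ℂ), 0 < U → δ ∈ Set.Ioo (0:ℝ) (1/2) → 0 < c' → (∃ L₁ : ℕ, ∀ (L : ℕ) [NeZero L], Even L → L₁ ≤ L → (P L).IsHermitian ∧ (∀ v, v ∈ Literature.MathematicalPhysics.QuantumLattice.szSector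 (2 * ⌊(1 - δ) * (L : ℝ) ^ 2 / 2⌋₊) 0 → P L *ᵥ v ∈ Literature.MathematicalPhysics.QuantumLattice.szSector (2 * ⌊(1 - δ) * (L : ℝ) ^ 2 / 2⌋₊) 0) ∧ (∀ s : ℝ, 0 < s → ∀ ψ, Literature.MathematicalPhysics.QuantumLattice.IsGroundStateInSector (Literature.MathematicalPhysics.QuantumLattice.hubbardTorus 2 L 1 U + (s : ℂ) • P L) (2 * ⌊(1 - δ) * (L : ℝ) ^ 2 / 2⌋₊) 0 ψ → star ψ ⬝ᵥ ψ = 1 → c' * (L : ℝ) ^ 4 ≤ (Literature.MathematicalPhysics.QuantumLattice.expect ((Literature.MathematicalPhysics.QuantumLattice.pairField Literature.MathematicalPhysics.QuantumLattice.dWaveFormFactor L)ᴴ * Literature.MathematicalPhysics.QuantumLattice.pairField Literature.MathematicalPhysics.QuantumLattice.dWaveFormFactor L) ψ).re) ∧ (∀ ψ₁ ψ₂, Literature.MathematicalPhysics.QuantumLattice.IsGroundStateInSector (Literature.MathematicalPhysics.QuantumLattice.hubbardTorus 2 L 1 U) (2 * ⌊(1 - δ) * (L : ℝ) ^ 2 /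 2⌋₊) 0 ψ₁ → Literature.MathematicalPhysics.QuantumLattice.IsGroundStateInSector (Literature.MathematicalPhysics.QuantumLattice.hubbardTorus 2 L 1 U) (2 * ⌊(1 - δ) * (L : ℝ) ^ 2 / 2⌋₊) 0 ψ₂ → ∃ a : ℂ, ψ₂ = a • ψ₁)) → ∀ (N : ℕ → ℕ) (ψ : ∀ L, Literature.MathematicalPhysics.QuantumLattice.Fock (Literature.MathematicalPhysics.QuantumLattice.Orb (Literature.MathematicalPhysics.QuantumLattice.FermionTorus 2 L))), (∀ L, Even L → N L = 2 * ⌊(1 - δ) * (L : ℝ) ^ 2 / 2⌋₊ ∧ star (ψ L) ⬝ᵥ ψ L = 1 ∧ Literature.MathematicalPhysics.QuantumLattice.IsGroundStateInSector (Literature.MathematicalPhysics.QuantumLattice.hubbardTorus 2 L 1 U) (N L) 0 (ψ L)) → Literature.Probability.LatticeModels.HasLongRangeOrder (fun k => Literature.Probability.LatticeModels.halfOpenBox 2 (2 * k)) (fun k => Literature.MathematicalPhysics.QuantumLattice.torusPullback (Literature.MathematicalPhysics.QuantumLattice.pairFieldCorr Literature.MathematicalPhysics.QuantumLattice.dWaveFormFactor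 ψ) (2 * k))

/-- item stmt-HubbardSuperconductivity-2657 · assembly · rank 1 · closed · proved by Summit.HubbardSuperconductivity.HubbardSuperconductivity.Theorems.RvbParentAnchor.rvbParentAnchor_assembly_proof @ ea2f0a5bd603 (prover) · by planner
sources: Scalapino1995
[assembly] AnchorExists → PathLRO → HubbardSuperconductivity (via EndpointTransfer). -/
@[route_item "route-HubbardSuperconductivity-RvbParentAnchor"]
def Assembly : Prop :=
  AnchorExists → PathLRO → HubbardSuperconductivity

/-! D-0027 §2.1 — DECIDING THEOREM (planner-authored via `route open/edit --closes-file`; by planner-rbadge-HubbardSuperconductivity-RvbPar-b66d70d9-g2-0 2026-08-15T16:16:53Z):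
its hypotheses are this route's items and its conclusion the sub-problem Statement (glue_lint), and it elaborates with this file. -/

/-- D-0027 §2.1 deciding theorem of route RvbParentAnchor: hypotheses = the route's crux `PathLRO`
(anchor ∧ continuation: δ, the frustration-free anchor family `P`, the repulsion `U`, the uniform
pair-field bound `c'` along the path `hubbardTorus 2 L 1 U + s • P L`, and simplicity of the Hubbard
sector ground state) and the support lemma `EndpointTransfer` (endpoint bookkeeping `s → 0`);
conclusion = the sub-problem Statement `HubbardSuperconductivity` by name. Proof: unpack `PathLRO`,
apply `EndpointTransfer` at `(U, δ, c', P)` to its path block, and supply the witnesses `U`, `δ` of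
`Literature.Hubbard.DWaveSuperconductivityHubbard` (`HubbardSuperconductivity_iff` is `Iff.rfl`).
`AnchorExists` is the `s = ∞` projection of `PathLRO` and is not a separate hypothesis. -/
@[closes "route-HubbardSuperconductivity-RvbParentAnchor"] theorem closes (hP : PathLRO) (hT : EndpointTransfer) : _root_.HubbardSuperconductivity := by
  obtain ⟨δ, hδ, _c, _hc, _r, _L₀, P, _hanchor, U, hU, c', hc', hpath⟩ := hP
  exact ⟨U, hU, δ, hδ, hT U δ c' P hU hδ hc' hpath⟩

end Summit.HubbardSuperconductivity.HubbardSuperconductivity.Theses.RvbParentAnchor
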